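import Summits.QuantumFields.YangMills.Theorems.IR.VacuumEscapeSpectralSeamCluster
import Summits.QuantumFields.YangMills.Theorems.IR.VacuumEscapeDefs
import Summits.QuantumFields.YangMills.Theorems.PencilRigidityWeakCouplingHypercubicLimitColdPressureClustering
import HarnessLib

/-!
# Line `vacuum_escape` (crux `BalabanLadder.IR`, stmt-QuantumFields-19354) — spectral seam, part 3/3:
# `SliceGapInUnits ∧ ColdPurity ⇒ GapInUnits` (registered stub `stub_spectralSeam`, PROVED)

The registered stub `stub_spectralSeam` of the skeleton `Cruxes/IR/Lines/vacuum_escape.lean` (ideator ym-ir-idea-8, v6; card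
`vacuum-maximal-correlation`, seam 2) — the transfer-matrix ∕ Feynman–Kac seam turning the GAP FACE `SliceGapInUnits` (second transfer
ratio `≤ e^{−c₁ a(β)}` through `traceExcess`, multiplicity constant free in `(β, S)`) and the THERMAL FACE `ColdPurity` (thermal
multiplicity of the half-height cold torus `x_{S+1}(β, 2S+1) ≤ K₀`) into the leaf currency `GapInUnits` (exponential clustering of all
gauge-invariant local observables at rate `min(c₁,1)·a(β)` on the symmetric tori `(2S+1)⁴`, separations `n ≤ S`) — is a THEOREM:
`spectralSeam_holds`, verbatim the stub's signature.

Route.  `abs_latticeConnectedCorr_le_of_gap_purity`: on each finite transfer model of the tree's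
`TraceNormColdPressure.stub_transferRepresentation` (Osterwalder–Seiler slicing of the torus `(2S+1)⁴`, observables of time-width `w`),
the gap input gives the contraction rate `e^{−μ}` on `Ω^⊥` (`stub_perpContraction`, `m → ∞`), the model trace excesses at times
`t ≥ S + 1` are `≤ e^{−μ(t−S−1)} x_{S+1} ≤ e^{−μ(t−S−1)} K₀` (`trace_excess_le_pow_mul`), and the cluster bound with the thermal term at
TOTAL time `P − 2w ≥ S + 1` (`traceCluster_total`, parts 1–2) needs trace excesses only at times `≥ S + 1` — which is exactly what
`ColdPurity` supplies (the tree's `abs_latticeConnectedCorr_le_of_coldPressure` needs them on the cold range `t ≥ (S+1)/2` instead).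
Result: `|⟨A; τ_n B⟩_{β,(2S+1)⁴}| ≤ C_A C_B e^{2w} (2 + 5K₀ + K₀²) e^{−μ n}` for all `n ≤ S`, every `S` (a priori bound when `n ≤ w` or
`S < 2w`).  [folklore: Osterwalder–Seiler 1978 §3 transfer-matrix formalism; Montvay–Münster (1.195); finite-dimensional bookkeeping]

HONEST FRAMING: a FORMAT seam (bookkeeping between currencies) of ONE line of ONE open gap-crux of a CONDITIONAL chain; it proves
nothing about weak coupling — the line's LOAD `stub_noStickySliceEvent` (XL) and thermal face `stub_coldPurity` stay open, as do
`BalabanLadder.IR`, a lattice gap, and the Yang–Mills mass gap (Clay); R4 of the ladder closes only the conditional finite-𝕋⁴ rung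
`BalabanLadder.UV`.
-/

set_option autoImplicit false

noncomputable section

open scoped BigOperators InnerProductSpace
open Filter Topology MeasureTheory
open Literature.MathematicalPhysics.QuantumFieldTheory Literature.MathematicalPhysics.QuantumLattice
open Summit.QuantumFields.YangMills.Cruxes.OSLegsFromFemtoAndGap.DlrCollarTransfer (GapInUnits)
open Summit.QuantumFields.YangMills.Theorems.WeakCouplingHypercubicLimit.TraceNormColdPressure
  (stub_transferRepresentation stub_perpContraction)
open Summit.QuantumFields.YangMills.Cruxes.IR.VacuumEscape.SpectralSeam (traceCluster_total trace_excess_le_pow_mul)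

namespace Summit.QuantumFields.YangMills.Cruxes.IR.VacuumEscape

/-! ## §1 Arithmetic of the rates -/

/-- One exponential term: `e^{−μ k} ≤ e^{2w} e^{−μ n}` whenever `n ≤ k + 2w`, `0 ≤ μ ≤ 1`. [folklore] -/
theorem exp_pow_le_of_le_add {μ : ℝ} (hμ0 : 0 ≤ μ) (hμ1 : μ ≤ 1) {n k w : ℕ} (h : n ≤ k + 2 * w) :
    Real.exp (-μ) ^ k ≤ Real.exp (2 * w) * Real.exp (-(μ * n)) := by
  rw [← Real.exp_nat_mul, ← Real.exp_add]
  refine Real.exp_le_exp.2 ?_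
  have hk : (n : ℝ) ≤ k + 2 * w := by exact_mod_cast h
  have hw : (0 : ℝ) ≤ w := Nat.cast_nonneg _
  nlinarith [mul_le_mul_of_nonneg_left hk hμ0, mul_le_mul_of_nonneg_right hμ1 hw]

/-- The seven terms of `traceCluster_total` on the symmetric torus `P = 2S+1` (exponents `a = P − n − w`, `b = n − w`,
`p = q = P − w`, `N = P`, trace excesses `≤ e^{−μ(t − S − 1)} K₀`), summed: `≤ e^{2w} (2 + 5K₀ + K₀²) e^{−μ n}` for
`w ≤ n ≤ S`, `0 ≤ μ ≤ 1`, `K₀ ≥ 0`. [folklore] -/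
theorem rate_bookkeeping_total {μ K₀ : ℝ} (hμ0 : 0 ≤ μ) (hμ1 : μ ≤ 1) (hK₀ : 0 ≤ K₀) {S n w : ℕ}
    (hwn : w ≤ n) (hn : n ≤ S) :
    Real.exp (-μ) ^ (n - w) + Real.exp (-μ) ^ (2 * S + 1 - n - w) +
        2 * (Real.exp (-μ) ^ ((2 * S + 1 - n - w) + (n - w) - (S + 1)) * K₀) +
        Real.exp (-μ) ^ (2 * S + 1 - (S + 1)) * K₀ + Real.exp (-μ) ^ (2 * S + 1 - w - (S + 1)) * K₀ +
        Real.exp (-μ) ^ (2 * S + 1 - w - (S + 1)) * K₀ +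
        Real.exp (-μ) ^ (2 * S + 1 - w - (S + 1)) * K₀ * (Real.exp (-μ) ^ (2 * S + 1 - w - (S + 1)) * K₀) ≤
      Real.exp (2 * w) * (2 + 5 * K₀ + K₀ ^ 2) * Real.exp (-(μ * n)) := by
  set E : ℝ := Real.exp (2 * w) * Real.exp (-(μ * n)) with hE
  have hE0 : 0 ≤ E := by positivity
  have hr0 : 0 ≤ Real.exp (-μ) := Real.exp_nonneg _
  have hr1 : Real.exp (-μ) ≤ 1 := Real.exp_le_one_iff.mpr (by linarith)
  have t1 : Real.exp (-μ) ^ (n - w) ≤ E := exp_pow_le_of_le_add hμ0 hμ1 (by omega)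
  have t2 : Real.exp (-μ) ^ (2 * S + 1 - n - w) ≤ E := exp_pow_le_of_le_add hμ0 hμ1 (by omega)
  have t3 : Real.exp (-μ) ^ ((2 * S + 1 - n - w) + (n - w) - (S + 1)) ≤ E :=
    exp_pow_le_of_le_add hμ0 hμ1 (by omega)
  have t4 : Real.exp (-μ) ^ (2 * S + 1 - (S + 1)) ≤ E := exp_pow_le_of_le_add hμ0 hμ1 (by omega)
  have t5 : Real.exp (-μ) ^ (2 * S + 1 - w - (S + 1)) ≤ E := exp_pow_le_of_le_add hμ0 hμ1 (by omega)
  have t5' : Real.exp (-μ) ^ (2 * S + 1 - w - (S + 1)) ≤ 1 := pow_le_one₀ hr0 hr1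
  have t7 : Real.exp (-μ) ^ (2 * S + 1 - w - (S + 1)) * K₀ * (Real.exp (-μ) ^ (2 * S + 1 - w - (S + 1)) * K₀) ≤
      E * K₀ ^ 2 := by
    have hx0 : 0 ≤ Real.exp (-μ) ^ (2 * S + 1 - w - (S + 1)) := pow_nonneg hr0 _
    calc Real.exp (-μ) ^ (2 * S + 1 - w - (S + 1)) * K₀ * (Real.exp (-μ) ^ (2 * S + 1 - w - (S + 1)) * K₀)
        = (Real.exp (-μ) ^ (2 * S + 1 - w - (S + 1))) * (Real.exp (-μ) ^ (2 * S + 1 - w - (S + 1))) * K₀ ^ 2 := by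
          ring
      _ ≤ E * 1 * K₀ ^ 2 := by
          refine mul_le_mul_of_nonneg_right (mul_le_mul t5 t5' hx0 hE0) (sq_nonneg _)
      _ = E * K₀ ^ 2 := by ring
  have e : Real.exp (2 * w) * (2 + 5 * K₀ + K₀ ^ 2) * Real.exp (-(μ * n)) =
      E + E + 2 * (E * K₀) + E * K₀ + E * K₀ + E * K₀ + E * K₀ ^ 2 := by
    rw [hE]; ring
  rw [e]
  have t3' := mul_le_mul_of_nonneg_right t3 hK₀
  have t4' := mul_le_mul_of_nonneg_right t4 hK₀
  have t5'' := mul_le_mul_of_nonneg_right t5 hK₀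
  linarith

/-! ## §2 Gap face ∧ thermal face at half height ⇒ clustering, fixed coupling and volume, explicit constant -/

section Clustering

variable {G : Type} [Group G] [TopologicalSpace G] [IsTopologicalGroup G] [CompactSpace G]
  [MeasurableSpace G] [BorelSpace G]

/-- Changing the (propositionally equal) time extent of a trace excess. -/
theorem traceExcess_eq_of_eq {N : ℕ} (ρ : G →* Matrix (Fin N) (Fin N) ℂ) (β : ℝ) (P : ℕ) [NeZero P]
    {m m' : ℕ} [NeZero m] [NeZero m'] (h : m = m') : traceExcess ρ β P m = traceExcess ρ β P m' := by
  subst h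
  rfl

/-- **Gap face ∧ half-height thermal face ⇒ clustering — fixed coupling, explicit constant.**  For bounded gauge-invariant
local observables `A, B` (bounds `C_A, C_B`) there is a time-width `w` such that at every `β ≥ 0`, every rate `μ ∈ [0, 1]`,
constants `K`, `K₀ ≥ 0` and EVERY spatial half-side `S`: if the trace excesses of the spatial torus `(2S+1)³` obey the gap bound
`x(t) ≤ K e^{−μ t}` for all `t ≥ 2` (only the RATE is used: `K` never enters the constant) and the half-height multiplicity bound
`x(S+1) ≤ K₀`, then `|⟨A; τ_n B⟩_{β,(2S+1)⁴}| ≤ C_A C_B e^{2w} (2 + 5K₀ + K₀²) e^{−μ n}` for all `n ≤ S`. [folklore] -/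
theorem abs_latticeConnectedCorr_le_of_gap_purity (r : LatticeRep G) (A B : YMSpecies G) {CA CB : ℝ}
    (hCA : ∀ U, |A.F U| ≤ CA) (hCB : ∀ U, |B.F U| ≤ CB) :
    ∃ w : ℕ, ∀ (β : ℝ), 0 ≤ β → ∀ (μ K K₀ : ℝ), 0 ≤ μ → μ ≤ 1 → 0 ≤ K₀ → ∀ S : ℕ,
      (∀ m : ℕ, traceExcess r.ρ β (2 * S + 1) (m + 2) ≤ K * Real.exp (-(μ * ((m + 2 : ℕ) : ℝ)))) →
      traceExcess r.ρ β (2 * S + 1) (S + 1) ≤ K₀ →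
      ∀ n : ℕ, n ≤ S →
        |latticeConnectedCorr r.ρ β (2 * S + 1) A.F B.F n| ≤
          CA * CB * Real.exp (2 * w) * (2 + 5 * K₀ + K₀ ^ 2) * Real.exp (-(μ * n)) := by
  have hCA0 : 0 ≤ CA := le_trans (abs_nonneg _) (hCA 1)
  have hCB0 : 0 ≤ CB := le_trans (abs_nonneg _) (hCB 1)
  obtain ⟨w, hw⟩ := stub_transferRepresentation G r A B
  refine ⟨w, ?_⟩
  intro β hβ μ K K₀ hμ0 hμ1 hK₀ S hgap hpur n hn
  have hexp0 : 0 ≤ Real.exp (-(μ * n)) := Real.exp_nonneg _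
  by_cases hcase : w < n ∧ 2 * w ≤ S
  · -- finite transfer models
    have hwn : w < n := hcase.1
    have h2w : 2 * w ≤ S := hcase.2
    have hS1 : 1 ≤ S := by omega
    -- the trace-excess function, made total and nonnegative
    set X : ℕ → ℝ := fun m => max 0 (traceExcess r.ρ β (2 * S + 1) (m - 2 + 2)) with hXdef
    have hX0 : ∀ m, 0 ≤ X m := fun m => le_max_left _ _
    have hXgap : ∀ m : ℕ, 2 ≤ m → X m ≤ 1 * max K 0 * Real.exp (-(μ * m)) := by
      intro m hm
      have h1 := hgap (m - 2)
      have e : m - 2 + 2 = m := by omega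
      have e' : ((m - 2 + 2 : ℕ) : ℝ) = (m : ℝ) := by rw [e]
      rw [e'] at h1
      rw [one_mul]
      refine max_le (by positivity) (h1.trans ?_)
      exact mul_le_mul_of_nonneg_right (le_max_left _ _) (Real.exp_nonneg _)
    have hXpur : X (S + 1) ≤ K₀ := by
      refine max_le hK₀ ?_
      rw [traceExcess_eq_of_eq r.ρ β (2 * S + 1) (show S + 1 - 2 + 2 = S + 1 by omega)]
      exact hpur
    have hmod := hw β hβ CA CB hCA hCB S n hn hwn h2w
    have key : |latticeConnectedCorr r.ρ β (2 * S + 1) A.F B.F n| ≤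
        CA * CB * (Real.exp (-μ) ^ (n - w) + Real.exp (-μ) ^ (2 * S + 1 - n - w) +
          2 * (Real.exp (-μ) ^ ((2 * S + 1 - n - w) + (n - w) - (S + 1)) * K₀) +
          Real.exp (-μ) ^ (2 * S + 1 - (S + 1)) * K₀ + Real.exp (-μ) ^ (2 * S + 1 - w - (S + 1)) * K₀ +
          Real.exp (-μ) ^ (2 * S + 1 - w - (S + 1)) * K₀ +
          Real.exp (-μ) ^ (2 * S + 1 - w - (S + 1)) * K₀ * (Real.exp (-μ) ^ (2 * S + 1 - w - (S + 1)) * K₀)) := by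
      refine le_of_forall_pos_le_add fun ε hε => ?_
      obtain ⟨d, T, Ao, Bo, Ω, hT, hΩ, hTΩ, hcon, hAo, hBo, hXT', hclose⟩ := hmod ε hε
      have hXT : ∀ m : ℕ, 2 ≤ m →
          LinearMap.trace ℝ _ (↑(T ^ m) : EuclideanSpace ℝ (Fin d) →ₗ[ℝ] EuclideanSpace ℝ (Fin d)) - 1 ≤ X m := by
        intro m hm
        have h := hXT' (m - 2)
        have e : m - 2 + 2 = m := by omega
        have hpow : T ^ m = T ^ (m - 2 + 2) := by rw [e]
        rw [hpow]
        exact h.trans (le_max_right _ _)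
      -- the contraction rate on `Ω^⊥` from the gap face (m → ∞)
      have hr : ∀ v, inner ℝ Ω v = 0 → ‖T v‖ ≤ Real.exp (-μ) * ‖v‖ :=
        stub_perpContraction d T Ω μ 1 (max K 0) 2 hT hΩ hTΩ hcon one_pos (fun m hm =>
          (hXT m hm).trans (hXgap m hm))
      have hr0 : 0 ≤ Real.exp (-μ) := Real.exp_nonneg _
      -- model trace excesses at times `≥ S + 1`
      have hXt : ∀ t : ℕ, S + 1 ≤ t →
          LinearMap.trace ℝ _ (↑(T ^ t) : EuclideanSpace ℝ (Fin d) →ₗ[ℝ] EuclideanSpace ℝ (Fin d)) - 1 ≤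
            Real.exp (-μ) ^ (t - (S + 1)) * K₀ := by
        intro t ht
        refine (trace_excess_le_pow_mul T Ω hT hΩ hTΩ hr0 hr ht).trans ?_
        exact mul_le_mul_of_nonneg_left ((hXT (S + 1) (by omega)).trans hXpur) (pow_nonneg hr0 _)
      -- the cluster bound on the model
      have ha1 : 1 ≤ 2 * S + 1 - n - w := by omega
      have hb1 : 1 ≤ n - w := by omega
      have hab : S + 1 ≤ (2 * S + 1 - n - w) + (n - w) := by omega
      have hN : S + 1 ≤ 2 * S + 1 := by omega
      have hp : S + 1 ≤ 2 * S + 1 - w := by omega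
      have htc := traceCluster_total d T Ao Bo Ω (Real.exp (-μ))
        (Real.exp (-μ) ^ ((2 * S + 1 - n - w) + (n - w) - (S + 1)) * K₀)
        (Real.exp (-μ) ^ (2 * S + 1 - (S + 1)) * K₀)
        (Real.exp (-μ) ^ (2 * S + 1 - w - (S + 1)) * K₀) (Real.exp (-μ) ^ (2 * S + 1 - w - (S + 1)) * K₀)
        (2 * S + 1 - n - w) (n - w) (2 * S + 1 - w) (2 * S + 1 - w) (2 * S + 1)
        hT hΩ hTΩ hr0 hr ha1 hb1 (hXt _ hab) (hXt _ hN) (hXt _ hp) (hXt _ hp)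
      -- monotonicity in the norms
      have hbr0 : 0 ≤ Real.exp (-μ) ^ (n - w) + Real.exp (-μ) ^ (2 * S + 1 - n - w) +
          2 * (Real.exp (-μ) ^ ((2 * S + 1 - n - w) + (n - w) - (S + 1)) * K₀) +
          Real.exp (-μ) ^ (2 * S + 1 - (S + 1)) * K₀ + Real.exp (-μ) ^ (2 * S + 1 - w - (S + 1)) * K₀ +
          Real.exp (-μ) ^ (2 * S + 1 - w - (S + 1)) * K₀ +
          Real.exp (-μ) ^ (2 * S + 1 - w - (S + 1)) * K₀ * (Real.exp (-μ) ^ (2 * S + 1 - w - (S + 1)) * K₀) := by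
        positivity
      have hnorm : ‖Ao‖ * ‖Bo‖ ≤ CA * CB := mul_le_mul hAo hBo (norm_nonneg _) hCA0
      have hmodel := htc.trans (mul_le_mul_of_nonneg_right hnorm hbr0)
      have htri := abs_sub_abs_le_abs_sub
        (latticeConnectedCorr r.ρ β (2 * S + 1) A.F B.F n)
        (LinearMap.trace ℝ _ (↑(T ^ (2 * S + 1 - n - w) * Ao * T ^ (n - w) * Bo) : EuclideanSpace ℝ (Fin d) →ₗ[ℝ] EuclideanSpace ℝ (Fin d)) / LinearMap.trace ℝ _ (↑(T ^ (2 * S + 1)) : EuclideanSpace ℝ (Fin d) →ₗ[ℝ] EuclideanSpace ℝ (Fin d)) - LinearMap.trace ℝ _ (↑(T ^ (2 * S + 1 - w) * Ao) : EuclideanSpace ℝ (Fin d) →ₗ[ℝ] EuclideanSpace ℝ (Fin d)) / LinearMap.trace ℝ _ (↑(T ^ (2 * S + 1)) : EuclideanSpace ℝ (Fin d) →ₗ[ℝ] EuclideanSpace ℝ (Fin d)) * (LinearMap.trace ℝ _ (↑(T ^ (2 * S + 1 - w) * Bo) : EuclideanSpace ℝ (Fin d) →ₗ[ℝ] EuclideanSpace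 ℝ (Fin d)) / LinearMap.trace ℝ _ (↑(T ^ (2 * S + 1)) : EuclideanSpace ℝ (Fin d) →ₗ[ℝ] EuclideanSpace ℝ (Fin d))))
      linarith
    calc |latticeConnectedCorr r.ρ β (2 * S + 1) A.F B.F n|
        ≤ _ := key
      _ ≤ CA * CB * (Real.exp (2 * w) * (2 + 5 * K₀ + K₀ ^ 2) * Real.exp (-(μ * n))) :=
          mul_le_mul_of_nonneg_left (rate_bookkeeping_total hμ0 hμ1 hK₀ hwn.le hn)
            (mul_nonneg hCA0 hCB0)
      _ = CA * CB * Real.exp (2 * w) * (2 + 5 * K₀ + K₀ ^ 2) * Real.exp (-(μ * n)) := by ring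
  · -- a priori bound
    have hap := WilsonBlockHeatBath.abs_latticeConnectedCorr_le_two_mul r β (2 * S + 1) hCA hCB n
    have hμn : μ * n ≤ 2 * w := by
      have hn2 : (n : ℝ) ≤ 2 * w := by
        rcases not_and_or.mp hcase with h | h
        · have : n ≤ w := Nat.le_of_not_lt h
          exact_mod_cast (by omega : n ≤ 2 * w)
        · have : S < 2 * w := Nat.lt_of_not_le h
          exact_mod_cast (by omega : n ≤ 2 * w)
      calc μ * n ≤ 1 * n := mul_le_mul_of_nonneg_right hμ1 (Nat.cast_nonneg _)
        _ = n := one_mul _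
        _ ≤ 2 * w := hn2
    have hone : 1 ≤ Real.exp (2 * w) * Real.exp (-(μ * n)) := by
      rw [← Real.exp_add]
      exact Real.one_le_exp (by linarith)
    have htwo : (2 : ℝ) ≤ 2 + 5 * K₀ + K₀ ^ 2 := by nlinarith
    have hCC : 0 ≤ CA * CB := mul_nonneg hCA0 hCB0
    calc |latticeConnectedCorr r.ρ β (2 * S + 1) A.F B.F n|
        ≤ 2 * (CA * CB) := hap
      _ = CA * CB * 2 * 1 := by ring
      _ ≤ CA * CB * (2 + 5 * K₀ + K₀ ^ 2) * (Real.exp (2 * w) * Real.exp (-(μ * n))) :=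
          mul_le_mul (mul_le_mul_of_nonneg_left htwo hCC) hone zero_le_one (by positivity)
      _ = CA * CB * Real.exp (2 * w) * (2 + 5 * K₀ + K₀ ^ 2) * Real.exp (-(μ * n)) := by ring

end Clustering

/-! ## §3 The registered stub `stub_spectralSeam`, PROVED -/

/-- **`stub_spectralSeam` of line `vacuum_escape` is a theorem** (verbatim the registered signature): for every compact `G`
(simplicity is not used), every lattice representation `r` and unit map `a` with `a > 0`, `a → 0`:
`SliceGapInUnits G r a → ColdPurity G r → GapInUnits G r a`, with clustering rate `min(c₁, 1)·a(β)` (`c₁` the rate of the gap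
face), thresholds `β ≥ max(β₂, β₂', β₇, 0)` (`a β ≤ 1` beyond `β₇`), `S ≥ max(S₁ β, S₁' β)`, and per-observable constant
`C_A C_B e^{2w}(2 + 5K₀ + K₀²)` (`K₀` the thermal face's constant; the gap face's `K(β, S)` is NOT used). -/
theorem spectralSeam_holds :
    ∀ (G : Type) [Group G] [TopologicalSpace G] [IsTopologicalGroup G] [CompactSpace G]
      [MeasurableSpace G] [BorelSpace G], IsCompactSimpleLieGroup G →
      ∀ (r : LatticeRep G) (a : ℝ → ℝ), (∀ β, 0 < a β) → Tendsto a atTop (𝓝 0) →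
        SliceGapInUnits G r a → ColdPurity G r → GapInUnits G r a := by
  intro G _ _ _ _ _ _ _hG r a ha ha0 hgap hpur
  obtain ⟨c₁, β₂, S₁, hc₁, hg⟩ := hgap
  obtain ⟨K₀, β₂', S₁', hp⟩ := hpur
  -- eventually `a β ≤ 1`
  obtain ⟨β₇, hβ₇⟩ : ∃ β₇ : ℝ, ∀ β : ℝ, β₇ ≤ β → a β ≤ 1 := by
    have hev : ∀ᶠ β in atTop, a β < 1 := ha0.eventually (gt_mem_nhds one_pos)
    obtain ⟨β₇, h⟩ := Filter.eventually_atTop.1 hev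
    exact ⟨β₇, fun β hβ => (h β hβ).le⟩
  set c : ℝ := min c₁ 1 with hc
  have hc0 : 0 < c := lt_min hc₁ one_pos
  have hcc₁ : c ≤ c₁ := min_le_left _ _
  have hc1 : c ≤ 1 := min_le_right _ _
  refine ⟨c, max (max β₂ β₂') (max β₇ 0), fun β => max (S₁ β) (S₁' β), hc0, fun A B => ?_⟩
  obtain ⟨CA, hCA⟩ := A.bounded
  obtain ⟨CB, hCB⟩ := B.bounded
  obtain ⟨w, hw⟩ := abs_latticeConnectedCorr_le_of_gap_purity r A B hCA hCB
  refine ⟨CA * CB * Real.exp (2 * w) * (2 + 5 * max K₀ 0 + (max K₀ 0) ^ 2), ?_⟩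
  intro β hβ S n hS hn
  have hβ₂ : β₂ ≤ β := le_trans (le_trans (le_max_left _ _) (le_max_left _ _)) hβ
  have hβ₂' : β₂' ≤ β := le_trans (le_trans (le_max_right _ _) (le_max_left _ _)) hβ
  have hβ7 : β₇ ≤ β := le_trans (le_trans (le_max_left _ _) (le_max_right _ _)) hβ
  have hβ0 : 0 ≤ β := le_trans (le_trans (le_max_right _ _) (le_max_right _ _)) hβ
  have hS₁ : S₁ β ≤ S := le_trans (le_max_left _ _) hS
  have hS₁' : S₁' β ≤ S := le_trans (le_max_right _ _) hS
  have haβ := ha β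
  have ha1 := hβ₇ β hβ7
  have hμ0 : 0 ≤ c * a β := mul_nonneg hc0.le haβ.le
  have hμ1 : c * a β ≤ 1 := by nlinarith
  obtain ⟨K, hK⟩ := hg β hβ₂ S hS₁
  have hgap' : ∀ m : ℕ, traceExcess r.ρ β (2 * S + 1) (m + 2) ≤
      max K 0 * Real.exp (-(c * a β * ((m + 2 : ℕ) : ℝ))) := by
    intro m
    have h := hK (m + 2) (by omega)
    refine h.trans ?_
    have hm0 : (0 : ℝ) ≤ ((m + 2 : ℕ) : ℝ) := Nat.cast_nonneg _
    calc K * Real.exp (-(c₁ * a β * ((m + 2 : ℕ) : ℝ)))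
        ≤ max K 0 * Real.exp (-(c₁ * a β * ((m + 2 : ℕ) : ℝ))) :=
          mul_le_mul_of_nonneg_right (le_max_left _ _) (Real.exp_nonneg _)
      _ ≤ max K 0 * Real.exp (-(c * a β * ((m + 2 : ℕ) : ℝ))) := by
          refine mul_le_mul_of_nonneg_left (Real.exp_le_exp.2 (neg_le_neg ?_)) (le_max_right _ _)
          exact mul_le_mul_of_nonneg_right (mul_le_mul_of_nonneg_right hcc₁ haβ.le) hm0
  have hpur' : traceExcess r.ρ β (2 * S + 1) (S + 1) ≤ max K₀ 0 :=
    (hp β hβ₂' S hS₁').trans (le_max_left _ _)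
  exact hw β hβ0 (c * a β) (max K 0) (max K₀ 0) hμ0 hμ1 (le_max_right _ _) S hgap' hpur' n hn

end Summit.QuantumFields.YangMills.Cruxes.IR.VacuumEscape

end
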